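import Literature.NumberTheory.Automorphic.ShimuraCurveCartanLevel
import Summits.BirchSwinnertonDyer.BirchSwinnertonDyer.Theorems.ErratumRoadFiveShimuraLevel
import Literature.NumberTheory.EllipticCurves.IsogenyIdProofs
import Mathlib.RepresentationTheory.Basic
import Mathlib.LinearAlgebra.Matrix.GeneralLinearGroup.Defs
import Mathlib.LinearAlgebra.Trace
import Mathlib.NumberTheory.Padics.PadicVal.Basic
import HarnessLib

/-!
# Crux 23422 `EulerHalvesAtThreeResidualUpperBound`, line `cartan`: the vocabulary of the CARTAN DEGREE LAW (F2) cut — the finite-group layer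
# (Cartan torus lattices of `GL₂(𝔽_q)`, the cubic-newvector character, S-K1′), the torus–degree datum, the lattice degree law, the transport
# `X₀^D(M) ↦ X_{(D, M; ∅)}`, and the two remaining open inputs (F2⁰), (F2b) as named `Prop`s (Defs; definitions + definitional lemmas only)

Seat `bsd-stepL-tam3-p1` (g20), LINE OWNER of crux 23422 (`--kind definition`; consumed by `Cruxes/EulerHalvesAtThreeResidualUpperBound/Lines/cartan.lean` v8
and by the proof file `…CartanDegreeOfStubs`). CONTENT = bsd-idea-10 g10's unregistered crux workfile `Cruxes/EulerHalvesAtThree/Lines/cartan_degree.lean` r2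
(sha16 53799b0f4d965e0e; farm rc 0) §1 ∕ §2 ∕ §3 VERBATIM as to the bodies (CREDIT: bsd-idea-10 g7–g10, paper proofs `CubicTorusPeriodRatioProof.md`,
`CartanHomLattice.md`, `K1-TameTwo.md`; idea-crit-14 V49∕V57∕V70), moved here because Cruxes workfiles are not importable modules and registered stubs
must be stated over tree vocabulary (lead prompt: definitions the route posits live in a reviewed Defs module, never in a skeleton).
* §1 `IsScalarMat`, `HasRatEigenvalue`, `cubicNewvectorCharMat`, `cubicNewvectorChar` (the character of `W_q = π_q^{K(q)}` on `GL₂(𝔽_q)` for a IV∕IV*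
  place with `3 ∣ c_q`), `CartanTorusLattice` (+ `IsSplitFixed`, `IsNonsplitFixed`), the OPEN closed statements `CubicTorusPeriodRatioAtThree[GeFive]`
  (S-K1′: `ord₃ B(w_s,w_s) − ord₃ B(w_C,w_C) = 1 + ord₃(q−1) − ord₃(q+1)`; paper-proved for `q ≥ 5`, PROVED at `q = 2` in `…CartanDegreeOfStubs`),
  `CartanTorusDegreeData`, `LatticeDegreeLawAtThree` — tagged with the conjecture attribute where OPEN (closed constants only, RULING 75).
* §2 `cartanOfShimura` ∕ `cpdOfSpd` ∕ `spdOfCpd` (`X₀^D(M)`-data ARE `(D, M; ∅)`-data: same group, same Hecke operators) with their `rfl` lemmas.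
* §3 `CartanEmptyDegreeIndep` ((F2⁰): presentation-independence of the class-minimal degree at `C = ∅`; type number one ∕ Skolem–Noether, Vignéras
  III §5 — citable modulo the transport) and `CartanHomLatticeDictionaryAtThree` ((F2b): the one-place hom-lattice dictionary; NOT IN PRINT, Kohen–Pacetti
  Rem. 3.8; the hardest open input of the line).
HONEST FRAMING: definitions and definitional lemmas only; nothing is asserted (every `Prop` here is consumed as a stub ∕ hypothesis downstream); no summit
statement, no route item is proved; BSD is proved for no curve. References: [cite: KohenPacetti2016, §2 (pp. 7–8), Rem. 3.8 (p. 15)]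
[cite: CaiShuTian2014, §1.2 p. 5, Prop. 3.8 p. 21] [cite: VignerasLNM800, Ch. III §5, Ch. I §2 Thm. 2.1] [cite: PastenShimura2024, §2 p. 12, Prop. 5.1].
-- adapted from Summits/BirchSwinnertonDyer/BirchSwinnertonDyer/Cruxes/EulerHalvesAtThree/Lines/cartan_degree.lean r2 (bsd-idea-10 g10), §1–§3
-/

set_option linter.dupNamespace false
set_option autoImplicit false

noncomputable section

open scoped Classical MatrixGroups NumberField UpperHalfPlane

namespace Summit.BirchSwinnertonDyer.BirchSwinnertonDyer.Theorems.CartanDegree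

open WeierstrassCurve IsDedekindDomain NumberField Field Literature.NumberTheory.EllipticCurves
  Literature.NumberTheory.EllipticCurves.ModularForms
  Literature.NumberTheory.EllipticCurves.Rank1Residual Literature.NumberTheory.Automorphic
  Summit.BirchSwinnertonDyer.Rank1Residual Summit.BirchSwinnertonDyer.BirchSwinnertonDyer.Theorems

/-! ## §1 The finite-group layer (integral representations of `GL₂(𝔽_q)` only) — from `Lines/cartan.lean` §1, uniform in `q ≠ 3` -/

/-- `M` is a scalar matrix. -/
def IsScalarMat {q : ℕ} (M : Matrix (Fin 2) (Fin 2) (ZMod q)) : Prop :=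
  M 0 1 = 0 ∧ M 1 0 = 0 ∧ M 0 0 = M 1 1

/-- `M` has an eigenvalue in `𝔽_q`: its characteristic polynomial `X² − tr M·X + det M` has a root (for odd `q` and
`Δ = tr² − 4 det ≠ 0` this is «`Δ` is a square», the test of `Lines/cartan.lean` §1; the present form is also right at `q = 2`). -/
def HasRatEigenvalue {q : ℕ} (M : Matrix (Fin 2) (Fin 2) (ZMod q)) : Prop :=
  ∃ x : ZMod q, x * x + M.det = M.trace * x

/-- The character of `W_q = π_q^{K(q)}` on `GL₂(𝔽_q)` (`q ≠ 3` prime; `π_q` the local representation of a curve with IV∕IV* reduction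
and `3 ∣ c_q`, conductor `q²`), written on matrices: with `Δ = tr² − 4·det`,
* `q ≡ 1 (3)` (`PS(χ,χ⁻¹)`, χ cubic, dim `q+1`): scalar `q+1`; non-semisimple `1`; split semisimple with eigenvalue ratio a cube `2`,
  otherwise `−1`; elliptic `0`;
* `q ≡ 2 (3)` (cuspidal `σ_θ`, θ cubic on `𝔽_{q²}^×/𝔽_q^×`, dim `q−1`): scalar `q−1`; non-semisimple `−1`; split semisimple `0`; elliptic
  with `g` a cube in `𝔽_q[g]^× ≅ 𝔽_{q²}^×` `−2`, otherwise `1` (at `q = 2`: the sign character of `GL₂(𝔽₂) ≅ S₃`).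
Checked against `|G| = Σ χ²` and the lattice traces for all `5 ≤ q ≤ 127` (`Lines/cartan.lean`, `CertSK1q5q7.lean`). -/
def cubicNewvectorCharMat (q : ℕ) (M : Matrix (Fin 2) (Fin 2) (ZMod q)) : ℤ :=
  let Δ : ZMod q := M.trace ^ 2 - 4 * M.det
  if q % 3 = 1 then
    (if Δ = 0 then (if IsScalarMat M then (q : ℤ) + 1 else 1)
     else if HasRatEigenvalue M then (if IsScalarMat (M ^ ((q - 1) / 3)) then 2 else -1)
     else 0)
  else
    (if Δ = 0 then (if IsScalarMat M then (q : ℤ) - 1 else -1)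
     else if HasRatEigenvalue M then 0
     else (if M ^ ((q ^ 2 - 1) / 3) = 1 then -2 else 1))

/-- The same character on `GL₂(𝔽_q)`. -/
def cubicNewvectorChar (q : ℕ) (g : GL (Fin 2) (ZMod q)) : ℤ :=
  cubicNewvectorCharMat q (g : Matrix (Fin 2) (Fin 2) (ZMod q))

/-- A CARTAN TORUS LATTICE at `q`: a `ℤ`-free `ℤ[GL₂(𝔽_q)]`-lattice with character `χ_{W_q}`, an invariant positive-definite symmetric
form, no non-zero `G`-fixed vector mod `3`, and a matrix `η` with irreducible characteristic polynomial whose centraliser `𝔽_q[η]^×` is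
THE non-split torus (all non-split tori are conjugate, and conjugation by `h ∈ G` carries fixed vectors to fixed vectors preserving `B`,
so nothing depends on the choice; for odd `q` the model `η = (0 ε; 1 0)`, `ε` a non-square, is the one of `Lines/cartan.lean`). The split
torus is the diagonal one. (In the dictionary: `𝓛 = Hom(J_X, E′)` for the Cartan cover `X`, `B` = the degree form.) -/
structure CartanTorusLattice (q : ℕ) where
  /-- rank of the lattice (`= dim W_q = q ± 1`, forced by `trace_eq` at `g = 1`). -/
  d : ℕ
  /-- the `GL₂(𝔽_q)`-action. -/
  ρ : Representation ℤ (GL (Fin 2) (ZMod q)) (Fin d → ℤ)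
  /-- `ρ ⊗ ℚ ≅ W_q`: the character is `cubicNewvectorChar q`. -/
  trace_eq : ∀ g, LinearMap.trace ℤ (Fin d → ℤ) (ρ g) = cubicNewvectorChar q g
  /-- an invariant symmetric positive-definite bilinear form. -/
  B : (Fin d → ℤ) →ₗ[ℤ] (Fin d → ℤ) →ₗ[ℤ] ℤ
  B_symm : ∀ x y, B x y = B y x
  B_pos : ∀ x, x ≠ 0 → 0 < B x x
  B_inv : ∀ g x y, B (ρ g x) (ρ g y) = B x y
  /-- no nonzero `G`-fixed vector mod `3`: `(𝓛/3𝓛)^G = 0`. -/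
  noFixedVectorModThree : ∀ v : Fin d → ℤ,
    (∀ g, ∃ w : Fin d → ℤ, ρ g v - v = (3 : ℤ) • w) → ∃ w : Fin d → ℤ, v = (3 : ℤ) • w
  /-- a matrix with no eigenvalue in `𝔽_q` (irreducible characteristic polynomial), defining the non-split torus `𝔽_q[η]^×`. -/
  η : Matrix (Fin 2) (Fin 2) (ZMod q)
  η_irred : ¬ HasRatEigenvalue η

/-- `v` is fixed by the split (diagonal) torus. -/
def CartanTorusLattice.IsSplitFixed {q : ℕ} (𝓛 : CartanTorusLattice q) (v : Fin 𝓛.d → ℤ) : Prop :=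
  ∀ g : GL (Fin 2) (ZMod q), (g : Matrix (Fin 2) (Fin 2) (ZMod q)) 0 1 = 0 →
    (g : Matrix (Fin 2) (Fin 2) (ZMod q)) 1 0 = 0 → 𝓛.ρ g v = v

/-- `v` is fixed by the non-split torus `𝔽_q[η]^×` (the centraliser of `η` in `GL₂(𝔽_q)`). -/
def CartanTorusLattice.IsNonsplitFixed {q : ℕ} (𝓛 : CartanTorusLattice q) (v : Fin 𝓛.d → ℤ) : Prop :=
  ∀ g : GL (Fin 2) (ZMod q), (g : Matrix (Fin 2) (Fin 2) (ZMod q)) * 𝓛.η = 𝓛.η * g → 𝓛.ρ g v = v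

/-- **S-K1′ (the finite-group kernel of the Cartan degree law)**: for generators `w_s`, `w_C` of the rank-one fixed lattices of the two
tori, `ord₃ B(w_s,w_s) − ord₃ B(w_C,w_C) = 1 + ord₃(q−1) − ord₃(q+1)`, stated additively in `ℕ`, for every prime `q ≠ 3`. -/
@[conjecture]
def CubicTorusPeriodRatioAtThree : Prop :=
  ∀ (q : ℕ), q.Prime → q ≠ 3 → ∀ (𝓛 : CartanTorusLattice q) (wS wC : Fin 𝓛.d → ℤ),
    𝓛.IsSplitFixed wS → (∀ v, 𝓛.IsSplitFixed v → ∃ m : ℤ, v = m • wS) →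
    𝓛.IsNonsplitFixed wC → (∀ v, 𝓛.IsNonsplitFixed v → ∃ m : ℤ, v = m • wC) →
    padicValInt 3 (𝓛.B wS wS) + padicValNat 3 (q + 1) = padicValInt 3 (𝓛.B wC wC) + 1 + padicValNat 3 (q - 1)

/-- S-K1′ on the PAPER-PROVED range `q ≥ 5` (the content of the stub (F2a); `q = 2` is the theorem `cubicTorusPeriodRatio_two` of §1b). -/
@[conjecture]
def CubicTorusPeriodRatioAtThreeGeFive : Prop :=
  ∀ (q : ℕ), q.Prime → 5 ≤ q → ∀ (𝓛 : CartanTorusLattice q) (wS wC : Fin 𝓛.d → ℤ),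
    𝓛.IsSplitFixed wS → (∀ v, 𝓛.IsSplitFixed v → ∃ m : ℤ, v = m • wS) →
    𝓛.IsNonsplitFixed wC → (∀ v, 𝓛.IsNonsplitFixed v → ∃ m : ℤ, v = m • wC) →
    padicValInt 3 (𝓛.B wS wS) + padicValNat 3 (q + 1) = padicValInt 3 (𝓛.B wC wC) + 1 + padicValNat 3 (q - 1)

/-- The TORUS–DEGREE DATUM of a Cartan place (interface D1 of `Lines/cartan.lean`): on top of the lattice, generators `w_s`, `w_C` of the
torus-fixed lines; the degree normalisation `c > 0` (`deg = c • B`); the torus-descended parametrisations `u_s = idx_s • w_s`,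
`u_C = idx_C • w_C` with the DESCENT facts `3 ∤ idx_T`; the two degrees `degX0` (class-minimal degree at level `(D, Mq²; C∖q)`) and
`degC` (class-minimal degree at level `(D, M; C)`); the SHEET COUNTS `c·B(u_s,u_s) = ½(q−1)²·degX0`, `c·B(u_C,u_C) = ½(q²−1)·degC`
(`T/{±1}` acts freely on the generic point; at `q = 2` the honest counts are `1` and `3` — the same relations with `c` halved). -/
structure CartanTorusDegreeData (q : ℕ) extends CartanTorusLattice q where
  /-- generators of the split- ∕ non-split-torus-fixed sublattices. -/
  wS : Fin d → ℤ
  wC : Fin d → ℤ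
  wS_fixed : toCartanTorusLattice.IsSplitFixed wS
  wC_fixed : toCartanTorusLattice.IsNonsplitFixed wC
  wS_gen : ∀ v, toCartanTorusLattice.IsSplitFixed v → ∃ m : ℤ, v = m • wS
  wC_gen : ∀ v, toCartanTorusLattice.IsNonsplitFixed v → ∃ m : ℤ, v = m • wC
  /-- degree normalisation `deg f = c · B(f,f)` on `𝓛`. -/
  c : ℚ
  c_pos : 0 < c
  /-- `u_s = π₀ ∘ pr_s`, `u_C = π_C ∘ pr_C` and their indices in the fixed lines. -/
  uS : Fin d → ℤ
  uC : Fin d → ℤ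
  idxS : ℤ
  idxC : ℤ
  uS_eq : uS = idxS • wS
  uC_eq : uC = idxC • wC
  /-- descent: the indices are prime to `3`. -/
  descent_s : ¬ (3 : ℤ) ∣ idxS
  descent_C : ¬ (3 : ℤ) ∣ idxC
  /-- the two degrees. -/
  degX0 : ℕ
  degC : ℕ
  degX0_pos : 0 < degX0
  degC_pos : 0 < degC
  /-- sheet counts. -/
  sheet_s : c * ((B uS uS : ℤ) : ℚ) = ((q : ℚ) - 1) ^ 2 / 2 * (degX0 : ℚ)
  sheet_C : c * ((B uC uC : ℤ) : ℚ) = ((q : ℚ) ^ 2 - 1) / 2 * (degC : ℚ)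

/-- The degree law ON THE LATTICE LAYER: for every torus–degree datum at a prime `q ≠ 3`, `ord₃ degX0 = ord₃ degC + 1`. -/
@[conjecture]
def LatticeDegreeLawAtThree : Prop :=
  ∀ (q : ℕ), q.Prime → q ≠ 3 → ∀ 𝒟 : CartanTorusDegreeData q,
    padicValNat 3 𝒟.degX0 = padicValNat 3 𝒟.degC + 1

/-! ## §2 The transport `X₀^D(M) ↦ X_{(D, M; ∅)}` (PROVED: same group, same Hecke operators, same data, same class-minimality) -/

section Transport

variable {D M : ℕ}

/-- An Eichler-level datum IS a Cartan datum with no Cartan place (`O = O₀`, all Cartan fields vacuous or trivial). [folklore] -/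
def cartanOfShimura (X : ShimuraCurveData D M) : CartanLevelCurveData D M ∅ where
  B := X.B
  squarefree := X.squarefree
  ramifiedPlaces_eq := X.ramifiedPlaces_eq
  coprime := by simp
  O₀ := X.O
  isEichlerOrder := X.isEichlerOrder
  O := X.O
  isOrder := X.isEichlerOrder.isOrder
  le := le_rfl
  smul_mem := fun x hx => by simpa using hx
  relIndex_eq := by simp
  saturated := fun x hx _ => hx
  isDivisionRing_mod := by simp
  ι := X.ι
  ι_injective := X.ι_injective
  fd := X.fd
  isFundamentalDomain_fd := X.isFundamentalDomain_fd

/-- Same Fuchsian group. [folklore] -/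
theorem Gamma_cartanOfShimura (X : ShimuraCurveData D M) : (cartanOfShimura X).Gamma = X.Gamma := rfl

/-- Same Hecke operators. [folklore] -/
theorem heckeFun_cartanOfShimura (X : ShimuraCurveData D M) (n : ℕ) (h : ℍ → ℂ) :
    (cartanOfShimura X).heckeFun n h = X.heckeFun n h := rfl

/-- Eichler-level parametrisation data are Cartan-`∅` parametrisation data (the Hecke condition off `D M ∏∅ = D M`). [folklore] -/
def cpdOfSpd {X : ShimuraCurveData D M} {W : WeierstrassCurve ℚ} (P : ShimuraParametrizationData X W) :
    CartanParametrizationData (cartanOfShimura X) W where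
  L := P.L
  isNeronLattice := P.isNeronLattice
  uniformize := P.uniformize
  ker_uniformize := P.ker_uniformize
  uniformize_surjective := P.uniformize_surjective
  uniformize_spec := P.uniformize_spec
  form := P.form
  basePoint := P.basePoint
  period_mem := P.period_mem
  hecke_eq := fun ℓ hℓ hnd => P.hecke_eq ℓ hℓ (by simpa using hnd)
  deg := P.deg
  deg_pos := P.deg_pos
  deg_spec := P.deg_spec

/-- … and conversely. [folklore] -/
def spdOfCpd {X : ShimuraCurveData D M} {W : WeierstrassCurve ℚ} (Q : CartanParametrizationData (cartanOfShimura X) W) :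
    ShimuraParametrizationData X W where
  L := Q.L
  isNeronLattice := Q.isNeronLattice
  uniformize := Q.uniformize
  ker_uniformize := Q.ker_uniformize
  uniformize_surjective := Q.uniformize_surjective
  uniformize_spec := Q.uniformize_spec
  form := Q.form
  basePoint := Q.basePoint
  period_mem := Q.period_mem
  hecke_eq := fun ℓ hℓ hnd => Q.hecke_eq ℓ hℓ (by simpa using hnd)
  deg := Q.deg
  deg_pos := Q.deg_pos
  deg_spec := Q.deg_spec

/-- The transported datum has the same degree. [folklore] -/
@[simp] theorem deg_cpdOfSpd {X : ShimuraCurveData D M} {W : WeierstrassCurve ℚ} (P : ShimuraParametrizationData X W) :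
    (cpdOfSpd P).deg = P.deg := rfl

/-- The transported datum has the same degree. [folklore] -/
@[simp] theorem deg_spdOfCpd {X : ShimuraCurveData D M} {W : WeierstrassCurve ℚ}
    (Q : CartanParametrizationData (cartanOfShimura X) W) : (spdOfCpd Q).deg = Q.deg := rfl

/-- Class-minimality transports (the competitors on `X_{(D,M;∅)}` are competitors on `X₀^D(M)`). [folklore] -/
theorem isMinimalFor_cpdOfSpd {X : ShimuraCurveData D M} {W' : WeierstrassCurve ℚ} {P : ShimuraParametrizationData X W'}
    {V : WeierstrassCurve ℚ} (h : P.IsMinimalFor V) : (cpdOfSpd P).IsMinimalFor V :=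
  ⟨h.1, fun W'' _ Q'' hiso => h.2 W'' (spdOfCpd Q'') hiso⟩

end Transport


/-! ## §3 The two remaining open inputs as named `Prop`s (the skeleton's stubs (F2⁰), (F2b) are `theorem stub_… : <these>`) -/

/-- **(F2⁰) — CITABLE modulo a transport: the class-minimal degree at level `(D, M; ∅)` does not depend on the presenting datum.** Two data
`X₁, X₂ : CartanLevelCurveData D M ∅` have isomorphic quaternion algebras (same ramification, Hasse–Brauer–Noether–Albert), conjugate
Eichler orders (Eichler: for `B` indefinite over `ℚ` the Eichler orders of a given level form ONE type — strong approximation), and real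
splittings differing by an inner automorphism of `M₂(ℝ)` (Skolem–Noether); so `Γ₂ = gΓ₁g⁻¹` with `g ∈ GL₂(ℝ)`, and `τ ↦ gτ` (or
`τ ↦ g·τ̄` if `det g < 0`, composed with complex conjugation on `W(ℂ)`, `W/ℚ`) carries parametrisation data of every `W''` on `X₁` to data
on `X₂` of the same degree and Hecke field, and back. Hence equal class-minimal degrees. Why it might fail: it does not for `D M ≥ 1`
(both existence statements are theorems in print); mis-typing risk only (orientation when `det g < 0`).
[cite: VignerasLNM800, Ch. III §5 (Cor. 5.7: class and type number of Eichler orders, indefinite case) and Ch. I §2 (Thm. 2.1 Skolem–Noether)] -/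
@[conjecture]
def CartanEmptyDegreeIndep : Prop :=
    ∀ (V : WeierstrassCurve ℚ) [V.IsElliptic] (D M : ℕ)
      (X₁ : CartanLevelCurveData D M ∅) (W₁ : WeierstrassCurve ℚ) [W₁.IsElliptic] (Q₁ : CartanParametrizationData X₁ W₁)
      (X₂ : CartanLevelCurveData D M ∅) (W₂ : WeierstrassCurve ℚ) [W₂.IsElliptic] (Q₂ : CartanParametrizationData X₂ W₂),
      Q₁.IsMinimalFor V → Q₂.IsMinimalFor V → Q₁.deg = Q₂.deg

/-- **(F2b) — THE ONE-PLACE HOM-LATTICE DICTIONARY (GEOMETRIC; refereed on paper, NOT IN PRINT; the hardest stub).** For `V` in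
X11b@3 with `Surj V 3`, conductor `N = D·M·∏_C p²`, a Cartan place `q ∈ C` (`q ≠ 3`, `q² ∥ N`, `3 ∣ c_q(V)`: reduction IV∕IV*, `π_q` of
conductor `q²` with `K_q`-unramified cubic inertial type), a class-minimal datum `Q` at level `(D, M; C)` and a class-minimal datum `Q'` at
level `(D, Mq²; C∖q)`, there is a torus–degree datum `𝒟` at `q` with `𝒟.degX0 = Q'.deg` and `𝒟.degC = Q.deg`. Intended construction
(`Cruxes/EulerHalvesAtThree/CartanHomLattice.md` v1.1): `X := X_{(D, M; C∖q)}` with FULL level `K(q)` at `q` (a `GL₂(𝔽_q)`-cover of both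
curves: `X/T_s ≅ X_{(D,Mq²;C∖q)}` after conjugating `K_s(q)` to `K₀(q²)`, `X/T_ns = X_{(D,M;C)}`); `𝓛 := Hom(J_X, E′) ≅ W_q^{int}` for the
optimal `E′` in the class (rank `dim W_q` by strong multiplicity one and the newvector theory at `q`; (1.1): `G` acts through
`GL₂(𝔽_q)`, the degree form is invariant); `u_T :=` (class-minimal parametrisation of the quotient) `∘ pr_T`, with SHEET COUNTS
`deg u_T = |T/±1|·deg` and DESCENT `3 ∤ [𝓛^T : ℤu_T]` (Prop. L1: the obstruction lives in `E′[3](ℚ(μ_q^∞))`, killed by `Surj V 3`;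
Prop. L2: (α) optimal vs. class-minimal curve — isogenies in the class have degree prime to `3` under `Irr V 3`; (β) Kempf descent at the
elliptic points of the intermediate quotients — isotropy representations are characters or induced from `ℚ(√−3)`, excluded by `Surj V 3`;
(γ) cusps — none for `D > 1`, Manin–Drinfeld + component count for `D = 1`); `(𝓛/3𝓛)^G = 0` from `Irr V 3`; the data `Q`, `Q'` being
ARBITRARY presentations is absorbed by type number one (as in (F2⁰)). Why it might fail: (β) at a placement where an intermediate
quotient has an order-`3` elliptic point whose isotropy acts on the `E′`-isotypic part non-trivially despite `Surj` (none found among the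
7 window placements checked), or a `q = 2` slip in the sheet counts (`K(2)`-structure vs `Γ₀(4)`, `K1-TameTwo.md` Lemma A). Size L.
[cite: KohenPacetti2016, Rem. 3.8 and §2 (arXiv:1403.7801v3 pp. 7–8, 15)] [cite: CaiShuTian2014, §1.2 p. 5 ((f,f)_U = deg f), Prop. 3.8 p. 21]
[cite: VignerasLNM800, Ch. III §5] -/
@[conjecture]
def CartanHomLatticeDictionaryAtThree : Prop :=
    ∀ (V : WeierstrassCurve ℚ) [V.IsElliptic] [V.IsGloballyMinimal], ClassX11b V 3 → Surj V 3 →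
      ∀ (N D M : ℕ) (C : Finset ℕ) (q : ℕ) [Fact q.Prime]
        (X : CartanLevelCurveData D M C) (W₁ : WeierstrassCurve ℚ) [W₁.IsElliptic] (Q : CartanParametrizationData X W₁)
        (X' : CartanLevelCurveData D (M * q ^ 2) (C.erase q)) (W₂ : WeierstrassCurve ℚ) [W₂.IsElliptic]
        (Q' : CartanParametrizationData X' W₂),
        V.conductorNorm ℤ = N → D * M * ∏ p ∈ C, p ^ 2 = N → q ∈ C → q ≠ 3 → ¬ q ^ 3 ∣ N →
        3 ∣ (V.baseChange ℚ_[q]).localTamagawaNumber ℤ_[q] →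
        Q.IsMinimalFor V → Q'.IsMinimalFor V →
        ∃ 𝒟 : CartanTorusDegreeData q, 𝒟.degX0 = Q'.deg ∧ 𝒟.degC = Q.deg

end Summit.BirchSwinnertonDyer.BirchSwinnertonDyer.Theorems.CartanDegree

end
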